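import Literature.Geometry.DiscreteGeometry.KissingSearchDefs
import Literature.Geometry.DiscreteGeometry.SphericalCodeHullVertexLink
import Literature.Geometry.DiscreteGeometry.SphericalCodeHullConnected
import HarnessLib

/-!
# The geometric dictionary of the growth search: a kissing configuration gives a `KConf`

Topic `Literature/Geometry/DiscreteGeometry`; provefact brick for `Hales2012_contactGraphTame` /
`Hales2012_contactGraphFccOrHcp`.  For `V ∈ 𝒱` (`IsKissingConfig S`, Hales 2012, Def. 1) the
unit configuration `X = V/2` (twelve unit vectors with pairwise inner products `1/2` or `≤ κ₀`)
is labelled by `0 … 11`, and the fan-refined hull triangulation `fanTriSets X`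
(`KissingFanTriangleSets.lean`) with its angles `triAngleAt` is transported to the labels.  All
the axioms of the abstract structure `KConf` of `KissingSearchStructure.lean` are PROVED here
from the tree:

* Part A — `Pfun_pos_of_three_tight`: the circumradius polynomial is positive on a fan
  triangle (`‖c‖² · Gram = Q` for the facet normal `c`, `‖c‖ < 2`, `Gram = orient3² > 0`);
* Part B — the labelling `lab / pt` of `X = V/2` and its bookkeeping;
* Part C — **`IsKissingConfig.kconf`**, the `KConf` of `V` (fields: two triangles per side and
  contacts are sides `card_filter_fanTriSets_eq_two(_of_contact)`, the gap, `≤ 4` contacts at a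
  point (Lemma 7), `≥ 23` contacts (weights of Theorem 3), node equation `sum_triAngleAt`,
  spherical law of cosines, circumradius, rhombus cap `inner_nonneg_of_two_apexes`,
  single-cycle links `fanTriSets_link`, connectedness `eq_of_fanTriSets_closed`, cover);
* Part D — **`contactGraphFccOrHcp_of_concl`**: `M.Concl` for `M = hS.kconf` gives the
  FCC-or-HCP isomorphism of the contact graph of `V` (`tameContactGraph 1 / 0`,
  `nonempty_tameContactGraph_one_iso_fcc / _zero_iso_hcp`), hence
  **`contactGraphFccOrHcp_of_forall_concl : (∀ M : KConf, M.Concl) → Hales2012_contactGraphFccOrHcp`**.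

## References
* T. C. Hales, arXiv:1209.6043 (2012), Definition 1, Theorem 3, Lemmas 7–9. [`Hales2012`]
-/

noncomputable section

namespace Literature.Geometry.DiscreteGeometry

namespace KissingSearch

open Real RealInnerProductSpace Finset

section Geometry

local notation "E3" => EuclideanSpace ℝ (Fin 3)

/-! ### Part A. The circumradius polynomial on a fan triangle -/

/-- **The circumradius polynomial is positive on three distinct vertices of a facet** of the
hull of twelve unit vectors with pairwise inner products `≤ 1/2`: writing the facet normal
`c = α v + β a + γ b`, the three equations `⟪c, v⟫ = ⟪c, a⟫ = ⟪c, b⟫ = 1` give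
`‖c‖² · G = Q` (`G` the Gram determinant `= orient3² > 0`, `Q = 4G − Pfun`), and `‖c‖ < 2`.
[cite: Hales2012, proof of Theorem 2 ("Euclidean triangular circumradius less than √3")] -/
theorem Pfun_pos_of_three_tight {X : Finset E3} (h12 : X.card = 12) (hX1 : ∀ y ∈ X, ‖y‖ = 1)
    (hp : ∀ y ∈ X, ∀ y' ∈ X, y ≠ y' → ⟪y, y'⟫ ≤ 1 / 2) {c : E3} (hc : c ∈ facetNormals X)
    {v a b : E3} (hv : v ∈ tightSet X c) (ha : a ∈ tightSet X c) (hb : b ∈ tightSet X c)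
    (hva : v ≠ a) (hvb : v ≠ b) (hab : a ≠ b) : 0 < Pfun ⟪v, a⟫ ⟪v, b⟫ ⟪a, b⟫ := by
  obtain ⟨hvX, hcv⟩ := mem_tightSet.1 hv
  obtain ⟨haX, hca⟩ := mem_tightSet.1 ha
  obtain ⟨hbX, hcb⟩ := mem_tightSet.1 hb
  have nv : ⟪v, v⟫ = 1 := by rw [real_inner_self_eq_norm_sq, hX1 v hvX, one_pow]
  have na : ⟪a, a⟫ = 1 := by rw [real_inner_self_eq_norm_sq, hX1 a haX, one_pow]
  have nb : ⟪b, b⟫ = 1 := by rw [real_inner_self_eq_norm_sq, hX1 b hbX, one_pow]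
  have hc2 : ‖c‖ < 2 := norm_lt_two_of_mem_facetNormals h12 hX1 hp hc
  have hli := linearIndependent_of_three_tight hX1 hc hv ha hb hva hvb hab
  have hO := orient3_ne_zero_of_three_tight hX1 hc hv ha hb hva hvb hab
  have hG : orient3 v a b ^ 2 =
      1 + 2 * ⟪v, a⟫ * ⟪v, b⟫ * ⟪a, b⟫ - ⟪v, a⟫ ^ 2 - ⟪v, b⟫ ^ 2 - ⟪a, b⟫ ^ 2 := by
    rw [orient3_sq_eq_gram, nv, na, nb, real_inner_comm v b]
    ring
  have hGpos : 0 < 1 + 2 * ⟪v, a⟫ * ⟪v, b⟫ * ⟪a, b⟫ - ⟪v, a⟫ ^ 2 - ⟪v, b⟫ ^ 2 - ⟪a, b⟫ ^ 2 := by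
    rw [← hG]; positivity
  obtain ⟨β, γ, α, hceq⟩ := exists_comb_of_linearIndependent hli c
  have e1 : α + β * ⟪v, a⟫ + γ * ⟪v, b⟫ = 1 := by
    have h := hcv
    rw [hceq, inner_add_left, inner_add_left, real_inner_smul_left, real_inner_smul_left,
      real_inner_smul_left, nv, real_inner_comm v a, real_inner_comm v b] at h
    linarith
  have e2 : α * ⟪v, a⟫ + β + γ * ⟪a, b⟫ = 1 := by
    have h := hca
    rw [hceq, inner_add_left, inner_add_left, real_inner_smul_left, real_inner_smul_left,
      real_inner_smul_left, na, real_inner_comm a b] at h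
    linarith
  have e3 : α * ⟪v, b⟫ + β * ⟪a, b⟫ + γ = 1 := by
    have h := hcb
    rw [hceq, inner_add_left, inner_add_left, real_inner_smul_left, real_inner_smul_left,
      real_inner_smul_left, nb] at h
    linarith
  have hcc : ‖c‖ ^ 2 = α + β + γ := by
    rw [← real_inner_self_eq_norm_sq]
    nth_rewrite 2 [hceq]
    rw [inner_add_right, inner_add_right, real_inner_smul_right, real_inner_smul_right,
      real_inner_smul_right, hca, hcb, hcv]
    ring
  have key : ‖c‖ ^ 2 * (1 + 2 * ⟪v, a⟫ * ⟪v, b⟫ * ⟪a, b⟫ - ⟪v, a⟫ ^ 2 - ⟪v, b⟫ ^ 2 - ⟪a, b⟫ ^ 2) =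
      3 - 2 * (⟪v, a⟫ + ⟪v, b⟫ + ⟪a, b⟫) + 2 * (⟪v, a⟫ * ⟪v, b⟫ + ⟪v, a⟫ * ⟪a, b⟫ + ⟪v, b⟫ * ⟪a, b⟫) -
        (⟪v, a⟫ ^ 2 + ⟪v, b⟫ ^ 2 + ⟪a, b⟫ ^ 2) := by
    rw [hcc]
    linear_combination ((1 - ⟪a, b⟫ ^ 2) + (⟪v, b⟫ * ⟪a, b⟫ - ⟪v, a⟫) + (⟪v, a⟫ * ⟪a, b⟫ - ⟪v, b⟫)) * e1 +
      ((⟪v, b⟫ * ⟪a, b⟫ - ⟪v, a⟫) + (1 - ⟪v, b⟫ ^ 2) + (⟪v, a⟫ * ⟪v, b⟫ - ⟪a, b⟫)) * e2 +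
      ((⟪v, a⟫ * ⟪a, b⟫ - ⟪v, b⟫) + (⟪v, a⟫ * ⟪v, b⟫ - ⟪a, b⟫) + (1 - ⟪v, a⟫ ^ 2)) * e3
  have hP : Pfun ⟪v, a⟫ ⟪v, b⟫ ⟪a, b⟫ =
      (4 - ‖c‖ ^ 2) * (1 + 2 * ⟪v, a⟫ * ⟪v, b⟫ * ⟪a, b⟫ - ⟪v, a⟫ ^ 2 - ⟪v, b⟫ ^ 2 - ⟪a, b⟫ ^ 2) := by
    unfold Pfun; linear_combination key
  rw [hP]
  have h4 : 0 < 4 - ‖c‖ ^ 2 := by nlinarith [norm_nonneg c]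
  positivity

end Geometry

end KissingSearch

section Dictionary

open Real RealInnerProductSpace Finset KissingSearch

local notation "E3" => EuclideanSpace ℝ (Fin 3)

/-! ### Part B. The labelling of the unit configuration -/

variable {S : Set E3}

/-- Distinct points of `V/2` have inner product `≤ 1/2`. [cite: Hales2012, Definition 1] -/
theorem IsKissingConfig.inner_le_half_of_mem_unitConfig (hS : IsKissingConfig S) :
    ∀ y ∈ hS.unitConfig, ∀ y' ∈ hS.unitConfig, y ≠ y' → ⟪y, y'⟫ ≤ 1 / 2 := fun _ hy _ hy' hne =>
  (hS.inner_of_mem_unitConfig hy hy' hne).elim le_of_eq fun h => by linarith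

/-- `0` is inside the hull of `V/2`. [cite: Hales2012, proof of Theorem 2] -/
theorem IsKissingConfig.zero_mem_interior_unitConfig (hS : IsKissingConfig S) :
    (0 : E3) ∈ interior (convexHull ℝ (hS.unitConfig : Set E3)) :=
  zero_mem_interior_convexHull_of_twelve_unit hS.card_unitConfig (fun _ hy => hS.norm_of_mem_unitConfig hy)
    hS.inner_le_half_of_mem_unitConfig

/-- The labelling `V/2 ≃ Fin 12`. [folklore] -/
def IsKissingConfig.labEquiv (hS : IsKissingConfig S) : {x // x ∈ hS.unitConfig} ≃ Fin 12 :=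
  hS.unitConfig.equivFin.trans (finCongr hS.card_unitConfig)

/-- **The label of a point** (`0` off the configuration). [folklore] -/
def IsKissingConfig.lab (hS : IsKissingConfig S) (x : E3) : ℕ :=
  if hx : x ∈ hS.unitConfig then (hS.labEquiv ⟨x, hx⟩ : ℕ) else 0

/-- **The point of a label** (`0` for labels `≥ 12`). [folklore] -/
def IsKissingConfig.pt (hS : IsKissingConfig S) (a : ℕ) : E3 :=
  if ha : a < 12 then ((hS.labEquiv.symm ⟨a, ha⟩ : {x // x ∈ hS.unitConfig}) : E3) else 0

/-- Points of labels are points of the configuration. [folklore] -/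
theorem IsKissingConfig.pt_mem (hS : IsKissingConfig S) {a : ℕ} (ha : a < 12) : hS.pt a ∈ hS.unitConfig := by
  unfold IsKissingConfig.pt; rw [dif_pos ha]; exact (hS.labEquiv.symm ⟨a, ha⟩).2

/-- Labels are `< 12`. [folklore] -/
theorem IsKissingConfig.lab_lt (hS : IsKissingConfig S) (x : E3) : hS.lab x < 12 := by
  unfold IsKissingConfig.lab; split_ifs
  · exact (hS.labEquiv _).2
  · norm_num

/-- `lab ∘ pt = id` on labels `< 12`. [folklore] -/
theorem IsKissingConfig.lab_pt (hS : IsKissingConfig S) {a : ℕ} (ha : a < 12) : hS.lab (hS.pt a) = a := by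
  unfold IsKissingConfig.lab
  rw [dif_pos (hS.pt_mem ha)]
  unfold IsKissingConfig.pt
  simp only [dif_pos ha, Subtype.coe_eta, Equiv.apply_symm_apply]

/-- `pt ∘ lab = id` on the configuration. [folklore] -/
theorem IsKissingConfig.pt_lab (hS : IsKissingConfig S) {x : E3} (hx : x ∈ hS.unitConfig) : hS.pt (hS.lab x) = x := by
  unfold IsKissingConfig.pt
  rw [dif_pos (hS.lab_lt x)]
  unfold IsKissingConfig.lab
  simp only [dif_pos hx, Fin.eta, Equiv.symm_apply_apply]

/-- `pt` is injective on labels `< 12`. [folklore] -/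
theorem IsKissingConfig.pt_inj (hS : IsKissingConfig S) {a b : ℕ} (ha : a < 12) (hb : b < 12)
    (h : hS.pt a = hS.pt b) : a = b := by
  rw [← hS.lab_pt ha, ← hS.lab_pt hb, h]

/-- Points of labels are unit vectors. [folklore] -/
theorem IsKissingConfig.norm_pt (hS : IsKissingConfig S) {a : ℕ} (ha : a < 12) : ‖hS.pt a‖ = 1 :=
  hS.norm_of_mem_unitConfig (hS.pt_mem ha)

/-- Membership in the label set of a set of points. [folklore] -/
theorem IsKissingConfig.mem_image_lab (hS : IsKissingConfig S) {t : Finset E3} (ht : t ⊆ hS.unitConfig)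
    {a : ℕ} : a ∈ t.image hS.lab ↔ a < 12 ∧ hS.pt a ∈ t := by
  rw [Finset.mem_image]
  constructor
  · rintro ⟨x, hx, rfl⟩
    exact ⟨hS.lab_lt x, by rw [hS.pt_lab (ht hx)]; exact hx⟩
  · rintro ⟨ha, hm⟩
    exact ⟨hS.pt a, hm, hS.lab_pt ha⟩

/-- The point set of the label set of `t ⊆ V/2` is `t`. [folklore] -/
theorem IsKissingConfig.image_pt_image_lab (hS : IsKissingConfig S) {t : Finset E3} (ht : t ⊆ hS.unitConfig) :
    (t.image hS.lab).image hS.pt = t := by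
  rw [Finset.image_image]
  conv_rhs => rw [← Finset.image_id (s := t)]
  exact Finset.image_congr fun x hx => hS.pt_lab (ht (Finset.mem_coe.1 hx))

/-- The label set of the point set of `tl ⊆ {0 … 11}` is `tl`. [folklore] -/
theorem IsKissingConfig.image_lab_image_pt (hS : IsKissingConfig S) {tl : Finset ℕ} (htl : ∀ a ∈ tl, a < 12) :
    (tl.image hS.pt).image hS.lab = tl := by
  rw [Finset.image_image]
  conv_rhs => rw [← Finset.image_id (s := tl)]
  exact Finset.image_congr fun a ha => hS.lab_pt (htl a (Finset.mem_coe.1 ha))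

/-- `lab` is injective on the configuration. [folklore] -/
theorem IsKissingConfig.lab_injOn (hS : IsKissingConfig S) : Set.InjOn hS.lab (hS.unitConfig : Set E3) :=
  fun x hx x' hx' h => by rw [← hS.pt_lab (Finset.mem_coe.1 hx), ← hS.pt_lab (Finset.mem_coe.1 hx'), h]

/-- Label sets have the same cardinality. [folklore] -/
theorem IsKissingConfig.card_image_lab (hS : IsKissingConfig S) {t : Finset E3} (ht : t ⊆ hS.unitConfig) :
    (t.image hS.lab).card = t.card :=
  Finset.card_image_of_injOn fun _ hx _ hx' h => hS.lab_injOn (ht (Finset.mem_coe.1 hx)) (ht (Finset.mem_coe.1 hx')) h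

/-- Taking label sets is injective on subsets of the configuration. [folklore] -/
theorem IsKissingConfig.eq_of_image_lab_eq (hS : IsKissingConfig S) {t t' : Finset E3} (ht : t ⊆ hS.unitConfig)
    (ht' : t' ⊆ hS.unitConfig) (h : t.image hS.lab = t'.image hS.lab) : t = t' := by
  rw [← hS.image_pt_image_lab ht, ← hS.image_pt_image_lab ht', h]

/-! ### Part C. The `KConf` of a kissing configuration -/

/-- **The labelled fan triangles.** [folklore] -/
def IsKissingConfig.kT (hS : IsKissingConfig S) : Finset (Finset ℕ) :=
  (fanTriSets hS.unitConfig).image fun t => t.image hS.lab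

/-- **The labelled angles**: the angle of the fan triangle with label set `tl` at the label
`v` (`0` if `v ∉ tl`). [folklore] -/
def IsKissingConfig.kang (hS : IsKissingConfig S) (tl : Finset ℕ) (v : ℕ) : ℝ :=
  if v ∈ tl then triAngleAt hS.unitConfig (tl.image hS.pt) (hS.pt v) else 0

/-- Membership in `kT`. [folklore] -/
theorem IsKissingConfig.mem_kT (hS : IsKissingConfig S) {tl : Finset ℕ} :
    tl ∈ hS.kT ↔ tl.image hS.pt ∈ fanTriSets hS.unitConfig ∧ ∀ a ∈ tl, a < 12 := by
  have hX1 : ∀ y ∈ hS.unitConfig, ‖y‖ = 1 := fun _ hy => hS.norm_of_mem_unitConfig hy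
  unfold IsKissingConfig.kT
  rw [Finset.mem_image]
  constructor
  · rintro ⟨t, ht, rfl⟩
    rw [hS.image_pt_image_lab (subset_of_mem_fanTriSets hX1 ht)]
    exact ⟨ht, fun a ha => (Finset.mem_image.1 ha).elim fun x hx => hx.2 ▸ hS.lab_lt x⟩
  · rintro ⟨ht, htl⟩
    exact ⟨tl.image hS.pt, ht, hS.image_lab_image_pt htl⟩

/-- For a labelled fan triangle, membership of labels is membership of points. [folklore] -/
theorem IsKissingConfig.mem_of_mem_kT (hS : IsKissingConfig S) {tl : Finset ℕ} (htl : tl ∈ hS.kT) {a : ℕ}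
    (ha : a < 12) : a ∈ tl ↔ hS.pt a ∈ tl.image hS.pt := by
  constructor
  · exact fun h => Finset.mem_image_of_mem _ h
  · intro h
    obtain ⟨b, hb, hba⟩ := Finset.mem_image.1 h
    rwa [← hS.pt_inj ((hS.mem_kT.1 htl).2 b hb) ha hba]

/-- The label set of a fan triangle is in `kT`, with the expected members. [folklore] -/
theorem IsKissingConfig.image_lab_mem_kT (hS : IsKissingConfig S) {t : Finset E3} (ht : t ∈ fanTriSets hS.unitConfig) :
    t.image hS.lab ∈ hS.kT :=
  Finset.mem_image_of_mem _ ht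

/-- The labelled angle on the label set of a fan triangle. [folklore] -/
theorem IsKissingConfig.kang_image_lab (hS : IsKissingConfig S) {t : Finset E3} (ht : t ∈ fanTriSets hS.unitConfig)
    {v : ℕ} (hv : v < 12) : hS.kang (t.image hS.lab) v = triAngleAt hS.unitConfig t (hS.pt v) := by
  have hX1 : ∀ y ∈ hS.unitConfig, ‖y‖ = 1 := fun _ hy => hS.norm_of_mem_unitConfig hy
  have htX := subset_of_mem_fanTriSets hX1 ht
  unfold IsKissingConfig.kang
  rw [hS.image_pt_image_lab htX]
  split_ifs with h
  · rfl
  · rw [hS.mem_image_lab htX] at h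
    exact (triAngleAt_eq_zero_of_not_mem fun hm => h ⟨hv, hm⟩).symm

/-- The vertex-set angle is at most `π` for every vertex set. [folklore] -/
theorem triAngleAt_le_pi' {X : Finset E3} (hX1 : ∀ y ∈ X, ‖y‖ = 1) (t : Finset E3) (y : E3) :
    triAngleAt X t y ≤ π := by
  by_cases h : t ∈ fanTriSets X
  · exact triAngleAt_le_pi hX1 h y
  · unfold triAngleAt
    rw [Finset.filter_eq_empty_iff.2 fun p hp heq => h (mem_fanTriSets.2 ⟨_, hp, heq⟩), Finset.sum_empty]
    positivity

/-- A labelled fan triangle with three given distinct labels is their set. [folklore] -/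
theorem IsKissingConfig.image_pt_eq_triple (hS : IsKissingConfig S) {tl : Finset ℕ} (htl : tl ∈ hS.kT)
    {v a b : ℕ} (hv : v ∈ tl) (ha : a ∈ tl) (hb : b ∈ tl) (hva : v ≠ a) (hvb : v ≠ b) (hab : a ≠ b) :
    tl.image hS.pt = {hS.pt v, hS.pt a, hS.pt b} := by
  have hX1 : ∀ y ∈ hS.unitConfig, ‖y‖ = 1 := fun _ hy => hS.norm_of_mem_unitConfig hy
  obtain ⟨ht, hlt⟩ := hS.mem_kT.1 htl
  have h3 := card_eq_three_of_mem_fanTriSets hX1 ht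
  have nva : hS.pt v ≠ hS.pt a := fun h => hva (hS.pt_inj (hlt v hv) (hlt a ha) h)
  have nvb : hS.pt v ≠ hS.pt b := fun h => hvb (hS.pt_inj (hlt v hv) (hlt b hb) h)
  have nab : hS.pt a ≠ hS.pt b := fun h => hab (hS.pt_inj (hlt a ha) (hlt b hb) h)
  symm
  apply Finset.eq_of_subset_of_card_le
  · intro x hx
    simp only [Finset.mem_insert, Finset.mem_singleton] at hx
    rcases hx with rfl | rfl | rfl
    · exact Finset.mem_image_of_mem _ hv
    · exact Finset.mem_image_of_mem _ ha
    · exact Finset.mem_image_of_mem _ hb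
  · rw [h3, Finset.card_insert_of_notMem, Finset.card_pair nab]
    simp only [Finset.mem_insert, Finset.mem_singleton, not_or]
    exact ⟨nva, nvb⟩

/-- **The `KConf` of a kissing configuration** `V ∈ 𝒱`: labels `0 … 11` for the points of
`V/2`, Gram entries `⟪·, ·⟫`, the labelled fan triangles of the hull of `V/2` and their
angles; all the axioms are theorems about `V`. [cite: Hales2012, Definition 1 and proof of Theorem 3] -/
def IsKissingConfig.kconf (hS : IsKissingConfig S) : KConf :=
  have hX1 : ∀ y ∈ hS.unitConfig, ‖y‖ = 1 := fun _ hy => hS.norm_of_mem_unitConfig hy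
  have h12 := hS.card_unitConfig
  have hp := hS.inner_le_half_of_mem_unitConfig
  have h0 := hS.zero_mem_interior_unitConfig
  { g := fun a b => ⟪hS.pt a, hS.pt b⟫
    T := hS.kT
    ang := hS.kang
    g_symm := fun a b => real_inner_comm _ _
    mem_T := fun tl htl => by
      obtain ⟨t, ht, rfl⟩ := Finset.mem_image.1 htl
      rw [hS.card_image_lab (subset_of_mem_fanTriSets hX1 ht)]
      exact ⟨card_eq_three_of_mem_fanTriSets hX1 ht, fun a _ => by
        obtain ⟨x, -, rfl⟩ := Finset.mem_image.1 ‹a ∈ _›; exact hS.lab_lt x⟩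
    card_T := by
      unfold IsKissingConfig.kT
      rw [Finset.card_image_of_injOn fun t ht t' ht' h => hS.eq_of_image_lab_eq
        (subset_of_mem_fanTriSets hX1 (Finset.mem_coe.1 ht)) (subset_of_mem_fanTriSets hX1 (Finset.mem_coe.1 ht')) h]
      exact card_fanTriSets h12 hX1 h0
    two := fun tl htl a ha b hb hab => by
      obtain ⟨ht, hlt⟩ := hS.mem_kT.1 htl
      have ha12 := hlt a ha
      have hb12 := hlt b hb
      have hpa : hS.pt a ∈ tl.image hS.pt := Finset.mem_image_of_mem _ ha
      have hpb : hS.pt b ∈ tl.image hS.pt := Finset.mem_image_of_mem _ hb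
      have hne : hS.pt a ≠ hS.pt b := fun h => hab (hS.pt_inj ha12 hb12 h)
      have h2 := card_filter_fanTriSets_eq_two hX1 h0 ht
        (Finset.insert_subset_iff.2 ⟨hpa, Finset.singleton_subset_iff.2 hpb⟩) (Finset.card_pair hne)
      rw [← h2]
      unfold IsKissingConfig.kT
      rw [Finset.filter_image, Finset.card_image_of_injOn fun t ht t' ht' h => hS.eq_of_image_lab_eq
        (subset_of_mem_fanTriSets hX1 (Finset.mem_filter.1 (Finset.mem_coe.1 ht)).1)
        (subset_of_mem_fanTriSets hX1 (Finset.mem_filter.1 (Finset.mem_coe.1 ht')).1) h]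
      congr 1
      refine Finset.filter_congr fun t ht => ?_
      have htX := subset_of_mem_fanTriSets hX1 ht
      simp only [hS.mem_image_lab htX, Finset.insert_subset_iff, Finset.singleton_subset_iff]
      tauto
    contact_side := fun a b ha hb hab hg => by
      have hne : hS.pt a ≠ hS.pt b := fun h => hab (hS.pt_inj ha hb h)
      obtain ⟨t, ht, hat, hbt⟩ := exists_mem_fanTriSets_of_contact hX1 h0 (by norm_num : (-1 : ℝ) < 1 / 2) hp
        (hS.pt_mem ha) (hS.pt_mem hb) hne hg
      have htX := subset_of_mem_fanTriSets hX1 ht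
      exact ⟨t.image hS.lab, hS.image_lab_mem_kT ht, (hS.mem_image_lab htX).2 ⟨ha, hat⟩, (hS.mem_image_lab htX).2 ⟨hb, hbt⟩⟩
    dichot := fun a b ha hb hab => by
      have hne : hS.pt a ≠ hS.pt b := fun h => hab (hS.pt_inj ha hb h)
      rcases hS.inner_of_mem_unitConfig (hS.pt_mem ha) (hS.pt_mem hb) hne with h | h
      · exact Or.inl h
      · right
        refine ⟨neg_one_le_real_inner_of_norm_eq_one (hS.norm_pt ha) (hS.norm_pt hb), ?_⟩
        unfold κ0R κ0; push_cast; linarith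
    side_bound := fun tl htl a ha b hb _ => by
      obtain ⟨ht, -⟩ := hS.mem_kT.1 htl
      have := neg_half_lt_inner_of_mem_fanTriSets h12 hX1 hp ht (Finset.mem_image_of_mem _ ha)
        (Finset.mem_image_of_mem _ hb)
      linarith
    cdeg_le := fun a ha => by
      refine le_trans ?_ (hS.card_filter_inner_eq_half_le_four (hS.pt_mem ha))
      refine Finset.card_le_card_of_injOn hS.pt (fun b hb => ?_) fun b hb b' hb' h => ?_
      · rw [Finset.mem_coe, Finset.mem_filter] at hb ⊢
        exact ⟨hS.pt_mem (Finset.mem_range.1 hb.1), hb.2.2⟩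
      · rw [Finset.mem_coe, Finset.mem_filter, Finset.mem_range] at hb hb'
        exact hS.pt_inj hb.1 hb'.1 h
    contacts_ge := by
      classical
      refine le_trans hS.twentythree_le (Finset.card_le_card_of_surjOn (fun p => ({hS.pt p.1, hS.pt p.2} : Finset E3)) ?_)
      intro T hT
      rw [Finset.mem_coe] at hT
      unfold contactPairsAt at hT
      rw [Finset.mem_filter, Finset.mem_powerset] at hT
      obtain ⟨hTX, u, v, huv, hin, rfl⟩ := hT
      have hu : u ∈ hS.unitConfig := hTX (by simp)
      have hv : v ∈ hS.unitConfig := hTX (by simp)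
      have hlab : hS.lab u ≠ hS.lab v := fun h => huv (hS.lab_injOn hu hv h)
      rcases Nat.lt_or_gt_of_ne hlab with hlt | hlt
      · refine ⟨(hS.lab u, hS.lab v), ?_, ?_⟩
        · rw [Finset.mem_coe, Finset.mem_filter, Finset.mem_product, Finset.mem_range, Finset.mem_range]
          exact ⟨⟨hS.lab_lt u, hS.lab_lt v⟩, hlt, by simp only [hS.pt_lab hu, hS.pt_lab hv]; exact hin⟩
        · simp only [hS.pt_lab hu, hS.pt_lab hv]
      · refine ⟨(hS.lab v, hS.lab u), ?_, ?_⟩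
        · rw [Finset.mem_coe, Finset.mem_filter, Finset.mem_product, Finset.mem_range, Finset.mem_range]
          exact ⟨⟨hS.lab_lt v, hS.lab_lt u⟩, hlt, by simp only [hS.pt_lab hu, hS.pt_lab hv, real_inner_comm u v]; exact hin⟩
        · simp only [hS.pt_lab hu, hS.pt_lab hv, Finset.pair_comm]
    node := fun v hv => by
      unfold IsKissingConfig.kT
      rw [Finset.sum_image fun t ht t' ht' h => hS.eq_of_image_lab_eq
        (subset_of_mem_fanTriSets hX1 ht) (subset_of_mem_fanTriSets hX1 ht') h]
      rw [Finset.sum_congr rfl fun t ht => hS.kang_image_lab ht hv]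
      exact sum_triAngleAt hX1 h0 (hS.pt_mem hv)
    ang_nonneg := fun tl v => by
      unfold IsKissingConfig.kang; split_ifs
      · exact triAngleAt_nonneg _ _ _
      · exact le_rfl
    ang_le_pi := fun tl v => by
      unfold IsKissingConfig.kang; split_ifs
      · exact triAngleAt_le_pi' hX1 _ _
      · positivity
    ang_zero := fun tl _ v hv => by
      unfold IsKissingConfig.kang; rw [if_neg hv]
    cos_law := fun tl htl v hv a ha b hb hva hvb hab => by
      obtain ⟨ht, hlt⟩ := hS.mem_kT.1 htl
      have nva : hS.pt v ≠ hS.pt a := fun h => hva (hS.pt_inj (hlt v hv) (hlt a ha) h)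
      have nvb : hS.pt v ≠ hS.pt b := fun h => hvb (hS.pt_inj (hlt v hv) (hlt b hb) h)
      have htri := hS.image_pt_eq_triple htl hv ha hb hva hvb hab
      have hang : hS.kang tl v = triAngleAt hS.unitConfig {hS.pt v, hS.pt a, hS.pt b} (hS.pt v) := by
        unfold IsKissingConfig.kang; rw [if_pos hv, htri]
      rw [htri] at ht
      have h := cos_triAngleAt_mul hX1 ht nva nvb
      have n1 : ‖perpTo (hS.pt v) (hS.pt a)‖ = Real.sqrt (1 - ⟪hS.pt v, hS.pt a⟫ ^ 2) := by
        rw [← norm_perpTo_sq_of_norm_eq_one (hS.norm_pt (hlt v hv)) (hS.norm_pt (hlt a ha)),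
          Real.sqrt_sq (norm_nonneg _)]
      have n2 : ‖perpTo (hS.pt v) (hS.pt b)‖ = Real.sqrt (1 - ⟪hS.pt v, hS.pt b⟫ ^ 2) := by
        rw [← norm_perpTo_sq_of_norm_eq_one (hS.norm_pt (hlt v hv)) (hS.norm_pt (hlt b hb)),
          Real.sqrt_sq (norm_nonneg _)]
      rw [hang, ← n1, ← n2, h]
    circum := fun tl htl v hv a ha b hb hva hvb hab => by
      obtain ⟨ht, hlt⟩ := hS.mem_kT.1 htl
      have nva : hS.pt v ≠ hS.pt a := fun h => hva (hS.pt_inj (hlt v hv) (hlt a ha) h)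
      have nvb : hS.pt v ≠ hS.pt b := fun h => hvb (hS.pt_inj (hlt v hv) (hlt b hb) h)
      have nab : hS.pt a ≠ hS.pt b := fun h => hab (hS.pt_inj (hlt a ha) (hlt b hb) h)
      obtain ⟨c, hc, htc⟩ := exists_subset_tightSet_of_mem_fanTriSets hX1 ht
      exact Pfun_pos_of_three_tight h12 hX1 hp hc (htc (Finset.mem_image_of_mem _ hv))
        (htc (Finset.mem_image_of_mem _ ha)) (htc (Finset.mem_image_of_mem _ hb)) nva nvb nab
    pairing := fun p q v w hpq hvw htv htw gvp gvq gwp gwq => by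
      obtain ⟨htv', hl1⟩ := hS.mem_kT.1 htv
      obtain ⟨htw', hl2⟩ := hS.mem_kT.1 htw
      have hp12 : p < 12 := hl1 p (by simp)
      have hq12 : q < 12 := hl1 q (by simp)
      have hv12 : v < 12 := hl1 v (by simp)
      have hw12 : w < 12 := hl2 w (by simp)
      have npq : hS.pt p ≠ hS.pt q := fun h => hpq (hS.pt_inj hp12 hq12 h)
      have nvw : hS.pt v ≠ hS.pt w := fun h => hvw (hS.pt_inj hv12 hw12 h)
      simp only [Finset.image_insert, Finset.image_singleton] at htv' htw'
      rw [real_inner_comm] at gvp gvq gwp gwq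
      exact inner_nonneg_of_two_apexes hX1 npq nvw htv' htw' (by rwa [real_inner_comm]) (by rwa [real_inner_comm])
        (by rwa [real_inner_comm]) (by rwa [real_inner_comm])
    link := fun v hv A hA hne hcl => by
      -- transport to the point sets
      set y := hS.pt v with hy
      have key := fanTriSets_link hX1 h0 (y := y) (A := A.image fun tl => tl.image hS.pt) ?_ ?_ ?_
      · -- back to labels
        have hAimg : (A.image fun tl => tl.image hS.pt).image (fun t => t.image hS.lab) = A := by
          rw [Finset.image_image]
          conv_rhs => rw [← Finset.image_id (s := A)]
          refine Finset.image_congr fun tl htl => ?_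
          have htlT := (Finset.mem_filter.1 (hA (Finset.mem_coe.1 htl))).1
          exact hS.image_lab_image_pt (hS.mem_kT.1 htlT).2
        rw [← hAimg, key]
        unfold IsKissingConfig.kT
        rw [Finset.filter_image]
        congr 1
        refine Finset.filter_congr fun t ht => ?_
        simp only [hS.mem_image_lab (subset_of_mem_fanTriSets hX1 ht), hv, true_and, hy]
      · intro t ht
        obtain ⟨tl, htl, rfl⟩ := Finset.mem_image.1 ht
        obtain ⟨htlT, hvtl⟩ := Finset.mem_filter.1 (hA htl)
        exact Finset.mem_filter.2 ⟨(hS.mem_kT.1 htlT).1, Finset.mem_image_of_mem _ hvtl⟩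
      · exact hne.image _
      · intro t ht t' ht' hyt' hcard
        obtain ⟨tl, htl, rfl⟩ := Finset.mem_image.1 ht
        obtain ⟨htlT, hvtl⟩ := Finset.mem_filter.1 (hA htl)
        have ht'X := subset_of_mem_fanTriSets hX1 ht'
        have htl' : t'.image hS.lab ∈ hS.kT := hS.image_lab_mem_kT ht'
        have hvtl' : v ∈ t'.image hS.lab := (hS.mem_image_lab ht'X).2 ⟨hv, hyt'⟩
        have hinter : (tl ∩ t'.image hS.lab).card = 2 := by
          have htlX : tl.image hS.pt ⊆ hS.unitConfig := subset_of_mem_fanTriSets hX1 (hS.mem_kT.1 htlT).1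
          have e1 : tl = (tl.image hS.pt).image hS.lab := (hS.image_lab_image_pt (hS.mem_kT.1 htlT).2).symm
          rw [e1, ← Finset.image_inter_of_injOn _ _ fun x hx x' hx' h => hS.lab_injOn ?_ ?_ h,
            hS.card_image_lab (Finset.inter_subset_left.trans htlX), hcard]
          · rcases hx with h' | h'
            · exact htlX (Finset.mem_coe.1 h')
            · exact ht'X (Finset.mem_coe.1 h')
          · rcases hx' with h' | h'
            · exact htlX (Finset.mem_coe.1 h')
            · exact ht'X (Finset.mem_coe.1 h')
        have hmem := hcl tl htl (t'.image hS.lab) htl' hvtl' hinter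
        rw [← hS.image_pt_image_lab ht'X]
        exact Finset.mem_image_of_mem _ hmem
    conn := fun D hD hne hcl => by
      have hDpt : D.image hS.pt ⊆ hS.unitConfig := by
        intro x hx
        obtain ⟨a, ha, rfl⟩ := Finset.mem_image.1 hx
        exact hS.pt_mem (Finset.mem_range.1 (hD ha))
      have key := eq_of_fanTriSets_closed hX1 h0 hDpt (hne.image _) fun t ht x hxt hxD => ?_
      · apply Finset.eq_of_subset_of_card_le hD
        rw [Finset.card_range, ← h12, ← key]
        exact Finset.card_image_le
      · obtain ⟨a, haD, rfl⟩ := Finset.mem_image.1 hxD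
        have ha12 := Finset.mem_range.1 (hD haD)
        have htX := subset_of_mem_fanTriSets hX1 ht
        have hsub := hcl (t.image hS.lab) (hS.image_lab_mem_kT ht) ⟨a, (hS.mem_image_lab htX).2 ⟨ha12, hxt⟩, haD⟩
        rw [← hS.image_pt_image_lab htX]
        exact Finset.image_subset_image hsub
    cover := fun v hv => by
      obtain ⟨c, hc⟩ := exists_mem_facetsAt hX1 h0 (hS.pt_mem hv)
      obtain ⟨hcF, hyc⟩ := mem_facetsAt.1 hc
      obtain ⟨i, hi, hyi, -⟩ := exists_fanTriangle_with_apex hX1 hcF hyc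
      have ht : fanVerts hS.unitConfig (c, i) ∈ fanTriSets hS.unitConfig := mem_fanTriSets.2 ⟨_, hi, rfl⟩
      exact ⟨_, hS.image_lab_mem_kT ht, (hS.mem_image_lab (subset_of_mem_fanTriSets hX1 ht)).2 ⟨hv, hyi⟩⟩ }

/-! ### Part D. From the conclusion of the search to the contact graph of `V` -/

/-- The half of a point of `V` is in `V/2`. [folklore] -/
theorem IsKissingConfig.half_mem_unitConfig (hS : IsKissingConfig S) {s : E3} (hs : s ∈ S) :
    (1 / 2 : ℝ) • s ∈ hS.unitConfig :=
  hS.mem_unitConfig.2 ⟨s, hs, rfl⟩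

/-- Twice a point of a label is in `V`. [folklore] -/
theorem IsKissingConfig.two_smul_pt_mem (hS : IsKissingConfig S) {a : ℕ} (ha : a < 12) : (2 : ℝ) • hS.pt a ∈ S := by
  obtain ⟨s, hs, h⟩ := hS.mem_unitConfig.1 (hS.pt_mem ha)
  rw [← h, smul_smul]; norm_num; exact hs

/-- The `Fin 12`-label of a point of `V`. [folklore] -/
def IsKissingConfig.flab (hS : IsKissingConfig S) (s : S) : Fin 12 :=
  ⟨hS.lab ((1 / 2 : ℝ) • (s : E3)), hS.lab_lt _⟩

/-- The point of `V` of a `Fin 12`-label. [folklore] -/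
def IsKissingConfig.fpt (hS : IsKissingConfig S) (k : Fin 12) : S :=
  ⟨(2 : ℝ) • hS.pt k, hS.two_smul_pt_mem k.2⟩

/-- `V ≃ Fin 12` by the labelling. [folklore] -/
def IsKissingConfig.equivFin (hS : IsKissingConfig S) : S ≃ Fin 12 where
  toFun := hS.flab
  invFun := hS.fpt
  left_inv s := by
    apply Subtype.ext
    show (2 : ℝ) • hS.pt (hS.lab ((1 / 2 : ℝ) • (s : E3))) = s
    rw [hS.pt_lab (hS.half_mem_unitConfig s.2), smul_smul]; norm_num
  right_inv k := by
    apply Fin.ext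
    show hS.lab ((1 / 2 : ℝ) • ((2 : ℝ) • hS.pt k)) = k
    rw [smul_smul, show (1 / 2 : ℝ) * 2 = 1 by norm_num, one_smul, hS.lab_pt k.2]

/-- The point of the label of `s ∈ V` is `s/2`. [folklore] -/
theorem IsKissingConfig.pt_flab (hS : IsKissingConfig S) (s : S) : hS.pt (hS.flab s) = (1 / 2 : ℝ) • (s : E3) :=
  hS.pt_lab (hS.half_mem_unitConfig s.2)

/-- Contact in `V` is inner product `1/2` in `V/2`. [folklore] -/
theorem IsKissingConfig.dist_eq_two_iff (hS : IsKissingConfig S) (s t : S) :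
    dist (s : E3) t = 2 ↔ ⟪(1 / 2 : ℝ) • (s : E3), (1 / 2 : ℝ) • (t : E3)⟫ = 1 / 2 := by
  have hd := dist_sq_eq_of_norm_eq_two (hS.norm_eq s.2) (hS.norm_eq t.2)
  rw [real_inner_smul_left, real_inner_smul_right]
  constructor
  · intro h; rw [h] at hd; linarith
  · intro h
    have h4 : dist (s : E3) t ^ 2 = 4 := by rw [hd]; linarith
    nlinarith [dist_nonneg (x := (s : E3)) (y := t)]

/-- **From the conclusion of the search to the contact graph.**  If the `KConf` of `V` has an
FCC or HCP contact graph (by a bijection of the labels), then the contact graph of `V` is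
isomorphic to that of the FCC or of the HCP kissing configuration. [cite: Hales2012, Lemma 9] -/
theorem IsKissingConfig.contactGraphFccOrHcp_of_concl (hS : IsKissingConfig S) (h : hS.kconf.Concl) :
    Nonempty (contactGraph S ≃g contactGraph ((fun p => (2 : ℝ) • p) '' (fccKissingPattern : Set E3))) ∨
    Nonempty (contactGraph S ≃g contactGraph ((fun p => (2 : ℝ) • p) '' (hcpKissingPattern : Set E3))) := by
  obtain ⟨i, hi, e, he⟩ := h
  -- the isomorphism with `tameContactGraph i`
  have iso : contactGraph S ≃g tameContactGraph i :=
    { toEquiv := hS.equivFin.trans e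
      map_rel_iff' := by
        intro s t
        show (tameContactGraph i).Adj (e (hS.flab s)) (e (hS.flab t)) ↔ (contactGraph S).Adj s t
        rw [tameContactGraph_adj, contactGraph_adj, hS.dist_eq_two_iff, ← he, ← he]
        change e (hS.flab s) ≠ e (hS.flab t) ∧
          (((hS.flab s : ℕ) ≠ hS.flab t ∧ ⟪hS.pt (hS.flab s), hS.pt (hS.flab t)⟫ = 1 / 2) ∨
           ((hS.flab t : ℕ) ≠ hS.flab s ∧ ⟪hS.pt (hS.flab t), hS.pt (hS.flab s)⟫ = 1 / 2)) ↔ _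
        rw [hS.pt_flab, hS.pt_flab, real_inner_comm ((1 / 2 : ℝ) • (t : E3))]
        constructor
        · rintro ⟨-, ⟨-, h⟩ | ⟨-, h⟩⟩ <;> exact h
        · intro h
          have hst : (s : E3) ≠ t := by
            intro hst
            rw [hst, real_inner_smul_left, real_inner_smul_right, real_inner_self_eq_norm_sq, hS.norm_eq t.2] at h
            norm_num at h
          have hlab : hS.flab s ≠ hS.flab t := by
            intro hl
            apply hst
            have h1 := hS.pt_flab s
            have h2 := hS.pt_flab t
            rw [hl] at h1
            exact smul_right_injective E3 (by norm_num : (1 / 2 : ℝ) ≠ 0) (h1.symm.trans h2)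
          refine ⟨fun h' => hlab (e.injective h'), Or.inl ⟨fun h' => hlab (Fin.ext h'), h⟩⟩ }
  rcases hi with rfl | rfl
  · exact Or.inr ⟨iso.trans nonempty_tameContactGraph_zero_iso_hcp.some⟩
  · exact Or.inl ⟨iso.trans nonempty_tameContactGraph_one_iso_fcc.some⟩

/-- **The geometric half of the classification**: if every `KConf` has an FCC or HCP contact
graph, then so has every kissing configuration `V ∈ 𝒱` (Hales 2012, Theorem 3 with Lemma 9, graph
form). [cite: Hales2012, Theorem 3 and Lemma 9] -/
theorem contactGraphFccOrHcp_of_forall_concl (h : ∀ M : KConf, M.Concl) : Hales2012_contactGraphFccOrHcp :=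
  fun _ hS => hS.contactGraphFccOrHcp_of_concl (h hS.kconf)

end Dictionary

end Literature.Geometry.DiscreteGeometry
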